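import Literature.MathematicalPhysics.QuantumLattice.HubbardGridFlowBudget
import HarnessLib

/-!
# A valid run of the multiscale flow of the Hubbard torus from the landed single-scale estimates

Topic `MathematicalPhysics/QuantumLattice`; cell gate-hubbard-kl, R0-SCOPE-4 W7 (assembly of the hypotheses).  `FlowSetup.Valid`
(`HubbardGridFlowBudget`) asks for Gram constants, row sums, slice tadpoles, the Hartree residual and two smallness conditions.  Here
the first three are discharged from the tree: the ultraviolet block's replica-stable determinant bound
(`isGramBoundedR_gridScaleCov_zero`, constant `κ₀ = 2√(1+κ_B²)`, `κ_B² = 8/(3π) + (1024/(3πc_{d₀}))Λ₀`), the slice Gram vectors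
(`isGramBoundedR_gridScaleCov_slice` with `κ_j² = AΛ_j`, `A = 256 r²/(3π c_{d₀})`, via `slice_gram_bound_le`), the row sums
(the properties provided by `exists_rowSum_gridScaleCov_zero/slice`, passed as hypotheses on the constants `C_uv`, `C_sl`), and
`‖t_j‖ ≤ AΛ_j` (`norm_gridScaleTadpole_le_A`); the Hartree residual, `‖ν₀‖ ≤ τ₀‖u‖`, `‖u‖ ≤ κ_U/β` and the smallness of `κ_U` remain
hypotheses (`FlowSetup.valid_of`).  The concrete side conditions: `β ≥ 1`, `μ_R` at distance `≥ d₀` from `{-4, 0}`, `|βθ| ≤ π/4`,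
`4π/β ≤ Λ₀ ≤ min(1, d₀/2)`, `Λ_1 ≤ Λ₀ ≤ rΛ_1` (the choice of `K`), `2 ≤ M`, `2M ≤ N`, `Λ₀β ≤ N`, `(Λ₀β)⁵ ≤ (2M-3)²`,
`Λ₀ < π(2M-3)/β`, `2β√(d₀/8) ≤ L` (Benfatto–Giuliani–Mastropietro 2006, §2.8: the inductive assumptions (2.80)–(2.81) at every scale).

Everything is proved; `kappaUV`, `sliceGramA` are the only definitions; no named facts.

## Sources

G. Benfatto, A. Giuliani, V. Mastropietro, Ann. Henri Poincaré 7 (2006) 809–898, §2.8 (2.80)–(2.88) (`BenfattoGiulianiMastropietro2006`);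
W. de Siqueira Pedra, M. Salmhofer, Comm. Math. Phys. 282 (2008) 797–818, Thm 2.4 (`PedraSalmhofer2008`).
-/

noncomputable section

namespace Literature.MathematicalPhysics.QuantumLattice

open Literature.Probability.LatticeModels GrassmannAlgebra Finset Complex

/-- **The Gram constant of the ultraviolet block** `κ₀ = 2√(1+κ_B²)`, `κ_B² = 8/(3π) + (1024/(3π c_{d₀}))Λ₀`. [cite: PedraSalmhofer2008, Thm 2.4] -/
def kappaUV (d₀ Λ₀ : ℝ) : ℝ :=
  2 * Real.sqrt (1 + (Real.sqrt (8 / (3 * Real.pi) + 1024 / (3 * Real.pi * (2 * Real.pi * Real.sqrt (d₀ / 8))) * Λ₀)) ^ 2)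

/-- **The slice Gram constant** `A = 256 r²/(3π c_{d₀})`. [cite: BenfattoGiulianiMastropietro2006, §2.8 (2.80)] -/
def sliceGramA (d₀ : ℝ) : ℝ := 256 * flowR ^ 2 / (3 * Real.pi * (2 * Real.pi * Real.sqrt (d₀ / 8)))

/-- `κ₀ > 0`. [cite: PedraSalmhofer2008, Thm 2.4] -/
theorem kappaUV_pos (d₀ Λ₀ : ℝ) : 0 < kappaUV d₀ Λ₀ := by
  unfold kappaUV; exact mul_pos two_pos (Real.sqrt_pos.2 (by positivity))

/-- `A > 0` (`d₀ > 0`). [cite: BenfattoGiulianiMastropietro2006, §2.8 (2.80)] -/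
theorem sliceGramA_pos {d₀ : ℝ} (hd₀ : 0 < d₀) : 0 < sliceGramA d₀ := by
  unfold sliceGramA; have := flowR_pos; positivity

namespace FlowSetup

variable {L M N : ℕ} [NeZero L] [NeZero N]

/-- **The concrete side conditions of a run** (those of the landed single-scale estimates), the row-sum properties of the
constants `C_uv`, `C_sl`, and the remaining hypotheses (Hartree residual, size of `ν₀`, `u`, smallness of `κ_U`).
[cite: BenfattoGiulianiMastropietro2006, §2.8 (2.80)-(2.88)] -/
structure Concrete (S : FlowSetup L M N) (d₀ : ℝ) : Prop where
  d₀_pos : 0 < d₀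
  A_eq : S.A = sliceGramA d₀
  κ₀_eq : S.κ₀ = kappaUV d₀ S.Λ₀
  one_le_β : 1 ≤ S.β
  Cuv_pos : 0 < S.Cuv
  Csl_pos : 0 < S.Csl
  τ₀_nonneg : 0 ≤ S.τ₀
  κU_nonneg : 0 ≤ S.κU
  μ4 : d₀ ≤ S.μR + 4
  μ0 : d₀ ≤ -S.μR
  θ_le : |S.β * S.θ| ≤ Real.pi / 4
  Λ₀β : 2 * (2 * Real.pi / S.β) ≤ S.Λ₀
  Λ₀_le_one : S.Λ₀ ≤ 1
  Λ₀d : S.Λ₀ ≤ d₀ / 2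
  K_ne_zero : S.K ≠ 0
  top_le : S.scale 1 ≤ S.Λ₀
  le_top : S.Λ₀ ≤ flowR * S.scale 1
  two_le_M : 2 ≤ M
  MN : 2 * M ≤ N
  Nβ : S.Λ₀ * S.β ≤ N
  Mβ : (S.Λ₀ * S.β) ^ 5 ≤ (2 * (M : ℝ) - 3) ^ 2
  Mπ : S.Λ₀ < Real.pi * (2 * M - 3) / S.β
  L_ge : 2 * S.β * Real.sqrt (d₀ / 8) ≤ L
  Cuv_rows : ∀ (L' M' N' : ℕ) [NeZero L'] [NeZero N'] (β μ θ r : ℝ) (K : ℕ),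
      0 < β → |β * θ| ≤ Real.pi / 4 → Real.pi / β ≤ S.Λ₀ → 2 * (2 * Real.pi / β) ≤ S.Λ₀ → 2 ≤ M' → 2 * M' ≤ N' → S.Λ₀ * β ≤ N' →
      (S.Λ₀ * β) ^ 5 ≤ (2 * (M' : ℝ) - 3) ^ 2 →
      (∀ X : GridLeg (GridPoint L' N'), ∑ Y, ‖gridScaleCov L' M' N' β μ θ S.Λ₀ r K 0 X Y‖ ≤ S.Cuv * (N' / β)) ∧
      (∀ Y : GridLeg (GridPoint L' N'), ∑ X, ‖gridScaleCov L' M' N' β μ θ S.Λ₀ r K 0 X Y‖ ≤ S.Cuv * (N' / β))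
  Csl_rows : ∀ (L' M' N' : ℕ) [NeZero L'] [NeZero N'] (β μ θ Λ₀ : ℝ) (K j : ℕ), j ≠ 0 → j ≤ K →
      0 < β → d₀ ≤ μ + 4 → d₀ ≤ -μ → |β * θ| ≤ Real.pi / 4 → Real.pi / β ≤ gridScale β Λ₀ flowR K j → gridScale β Λ₀ flowR K j ≤ 1 →
      gridScale β Λ₀ flowR K j ≤ gridScale β Λ₀ flowR K (j - 1) → gridScale β Λ₀ flowR K (j - 1) ≤ flowR * gridScale β Λ₀ flowR K j →
      gridScale β Λ₀ flowR K (j - 1) ≤ d₀ / 2 → gridScale β Λ₀ flowR K (j - 1) < Real.pi * (2 * M' - 3) / β → 2 * M' ≤ N' → 2 ≤ M' →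
      gridScale β Λ₀ flowR K j * β ≤ N' → 2 * Real.pi * Real.sqrt (d₀ / 8) ≤ gridScale β Λ₀ flowR K (j - 1) * L' →
      (∀ X : GridLeg (GridPoint L' N'), ∑ Y, ‖gridScaleCov L' M' N' β μ θ Λ₀ flowR K j X Y‖ ≤
          S.Csl * (N' / β) / (gridScale β Λ₀ flowR K j * Real.sqrt (gridScale β Λ₀ flowR K j))) ∧
      (∀ Y : GridLeg (GridPoint L' N'), ∑ X, ‖gridScaleCov L' M' N' β μ θ Λ₀ flowR K j X Y‖ ≤
          S.Csl * (N' / β) / (gridScale β Λ₀ flowR K j * Real.sqrt (gridScale β Λ₀ flowR K j)))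
  res : ‖S.ν₀ + S.u * ∑ i ∈ range (S.K + 1), S.tad i‖ ≤ ‖S.u‖ * (Real.pi / S.β)
  nu0 : ‖S.ν₀‖ ≤ S.τ₀ * ‖S.u‖
  u_le : ‖S.u‖ ≤ S.κU / S.β
  small₁ : S.κU * (S.E₄ + S.E₂ / Real.sqrt Real.pi) ≤ 1 / 60
  small₂ : S.κU ^ 2 * S.E₆ ≤ 1 / 60

variable {S : FlowSetup L M N} {d₀ : ℝ}

omit [NeZero N] in
/-- Elementary consequences of the concrete conditions. [cite: BenfattoGiulianiMastropietro2006, §2.8 (2.80)] -/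
theorem Concrete.basic (h : S.Concrete d₀) :
    0 < S.β ∧ Real.pi / S.β ≤ S.Λ₀ ∧ 0 < S.Λ₀ ∧ |S.θ| ≤ Real.pi / (4 * S.β) ∧ 0 < S.A ∧
      2 * Real.pi * Real.sqrt (d₀ / 8) ≤ Real.pi / S.β * L := by
  have hβ0 : 0 < S.β := lt_of_lt_of_le one_pos h.one_le_β
  have hπβ : Real.pi / S.β ≤ S.Λ₀ := by
    have h2 : Real.pi / S.β ≤ 2 * (2 * Real.pi / S.β) := by
      rw [div_le_iff₀ hβ0]; field_simp; nlinarith [Real.pi_pos, hβ0]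
    exact h2.trans h.Λ₀β
  have hΛ₀ : 0 < S.Λ₀ := lt_of_lt_of_le (by positivity) hπβ
  have hθ' : |S.θ| ≤ Real.pi / (4 * S.β) := by
    have hθ := h.θ_le
    rw [abs_mul, abs_of_pos hβ0] at hθ; rw [le_div_iff₀ (by positivity)]; linarith
  have hApos : 0 < S.A := by rw [h.A_eq]; exact sliceGramA_pos h.d₀_pos
  have hcL : 2 * Real.pi * Real.sqrt (d₀ / 8) ≤ Real.pi / S.β * L := by
    rw [show Real.pi / S.β * L = Real.pi * L / S.β by ring, le_div_iff₀ hβ0]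
    nlinarith [h.L_ge, Real.pi_pos, Real.sqrt_nonneg (d₀ / 8)]
  exact ⟨hβ0, hπβ, hΛ₀, hθ', hApos, hcL⟩

omit [NeZero N] in
/-- The scale facts at `1 ≤ j ≤ K`. [cite: BenfattoGiulianiMastropietro2006, §2.2 (2.9)] -/
theorem Concrete.scale_facts (h : S.Concrete d₀) {j : ℕ} (hj : j ≠ 0) (hjK : j ≤ S.K) :
    Real.pi / S.β ≤ S.scale j ∧ S.scale j ≤ S.scale (j - 1) ∧ S.scale (j - 1) ≤ flowR * S.scale j ∧ S.scale (j - 1) ≤ S.Λ₀ ∧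
      S.scale j ≤ 1 ∧ 2 * Real.pi * Real.sqrt (d₀ / 8) ≤ S.scale (j - 1) * L ∧ 0 < S.scale j := by
  obtain ⟨hβ0, -, -, -, -, hcL⟩ := h.basic
  have hL0 : (0 : ℝ) < L := by exact_mod_cast Nat.pos_of_ne_zero (NeZero.ne L)
  have h1 := pi_div_le_gridScale hβ0 S.Λ₀ S.K hj
  obtain ⟨h2, h3⟩ := gridScale_pred_bounds hβ0 h.top_le h.le_top hj hjK
  have h4 : S.scale (j - 1) ≤ S.Λ₀ := by
    rcases Nat.eq_zero_or_pos (j - 1) with h0 | hpos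
    · rw [scale, h0, gridScale_zero]
    · exact (gridScale_le_one' hβ0 S.Λ₀ (by omega)).trans h.top_le
  exact ⟨h1, h2, h3, h4, (h2.trans h4).trans h.Λ₀_le_one, hcL.trans (mul_le_mul_of_nonneg_right (h1.trans h2) hL0.le),
    lt_of_lt_of_le (by positivity) h1⟩

omit [NeZero N] in
/-- **Gram constants** from the landed determinant/Gram bounds. [cite: PedraSalmhofer2008, Thm 2.4] -/
theorem Concrete.gram (h : S.Concrete d₀) (j : ℕ) : IsGramBoundedR (S.cov j) (S.kap j) := by
  obtain ⟨hβ0, hπβ, hΛ₀, hθ', hApos, -⟩ := h.basic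
  have hL0 : (0 : ℝ) < L := by exact_mod_cast Nat.pos_of_ne_zero (NeZero.ne L)
  have hM0 : 0 < M := lt_of_lt_of_le two_pos h.two_le_M
  rcases Nat.eq_zero_or_pos j with rfl | hjpos
  · have h0 := isGramBoundedR_gridScaleCov_zero (L := L) (N := N) hβ0 hM0 h.μ4 h.μ0 h.θ_le hΛ₀ h.Λ₀d h.L_ge flowR S.K
    have hk : S.kap 0 = kappaUV d₀ S.Λ₀ := by simp [kap, flowKap, h.κ₀_eq]
    rw [cov, hk, kappaUV]; exact h0
  · rcases Nat.lt_or_ge S.K j with hKj | hjK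
    · have hk : S.kap j = 1 := by simp [kap, flowKap, show j ≠ 0 by omega, show ¬ j ≤ S.K by omega]
      rw [hk]; exact isGramBoundedR_gridScaleCov_of_lt S.β S.μR S.θ S.Λ₀ flowR hKj zero_le_one
    · have hj : j ≠ 0 := by omega
      obtain ⟨h1, h2, h3, h4, -, h6, hΛ⟩ := h.scale_facts hj hjK
      refine isGramBoundedR_gridScaleCov_slice hβ0 h.μ4 h.μ0 h.θ_le S.Λ₀ flowR hj hjK hΛ h2 (h4.trans h.Λ₀d)
        (flowKap_pos hApos (by rw [h.κ₀_eq]; exact kappaUV_pos _ _) hβ0 j).le ?_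
      rw [show S.kap j ^ 2 = S.A * S.scale j from flowKap_sq hApos.le hβ0 hj hjK]
      refine (slice_gram_bound_le hβ0 hL0 h.d₀_pos hΛ (h1.trans h2) h6).trans ?_
      rw [h.A_eq, sliceGramA,
        show 256 * flowR ^ 2 / (3 * Real.pi * (2 * Real.pi * Real.sqrt (d₀ / 8))) * S.scale j =
          256 / (3 * Real.pi * (2 * Real.pi * Real.sqrt (d₀ / 8))) * (flowR ^ 2 * S.scale j) by ring]
      have hd₀ := h.d₀_pos
      refine mul_le_mul_of_nonneg_left ?_ (by positivity)
      rw [div_le_iff₀ hΛ]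
      have h0 : 0 ≤ S.scale (j - 1) := (lt_of_lt_of_le (by positivity) (h1.trans h2)).le
      have := mul_le_mul h3 h3 h0 (mul_nonneg flowR_pos.le hΛ.le)
      nlinarith

/-- **Row and column sums** from the landed `L¹` bounds. [cite: BenfattoGiulianiMastropietro2006, §2.8 (2.81)] -/
theorem Concrete.rows_cols (h : S.Concrete d₀) (j : ℕ) :
    (∀ X, ∑ Y, ‖S.cov j X Y‖ ≤ S.alp j) ∧ (∀ Y, ∑ X, ‖S.cov j X Y‖ ≤ S.alp j) := by
  obtain ⟨hβ0, hπβ, hΛ₀, -, -, -⟩ := h.basic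
  rcases Nat.eq_zero_or_pos j with rfl | hjpos
  · have h0 := h.Cuv_rows L M N S.β S.μR S.θ flowR S.K hβ0 h.θ_le hπβ h.Λ₀β h.two_le_M h.MN h.Nβ h.Mβ
    have ha : S.alp 0 = S.Cuv * (N / S.β) := by simp [alp]
    rw [ha]; exact h0
  · rcases Nat.lt_or_ge S.K j with hKj | hjK
    · have ha : S.alp j = 1 := by simp [alp, show j ≠ 0 by omega, show ¬ j ≤ S.K by omega]
      have hc : S.cov j = 0 := gridScaleCov_of_lt S.β S.μR S.θ S.Λ₀ flowR hKj
      rw [ha, hc]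
      exact ⟨fun X => by simp, fun Y => by simp⟩
    · have hj : j ≠ 0 := by omega
      obtain ⟨h1, h2, h3, h4, h5, h6, -⟩ := h.scale_facts hj hjK
      have hNj : S.scale j * S.β ≤ N := (mul_le_mul_of_nonneg_right (h2.trans h4) hβ0.le).trans h.Nβ
      have h0 := h.Csl_rows L M N S.β S.μR S.θ S.Λ₀ S.K j hj hjK hβ0 h.μ4 h.μ0 h.θ_le h1 h5 h2 h3 (h4.trans h.Λ₀d)
        (lt_of_le_of_lt h4 h.Mπ) h.MN h.two_le_M hNj h6
      have ha : S.alp j = S.Csl * (N / S.β) / (S.scale j * Real.sqrt (S.scale j)) := by simp [alp, hj, hjK]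
      rw [ha]; exact h0

omit [NeZero N] in
/-- **Slice tadpoles** `‖t_j‖ ≤ AΛ_j`. [cite: BenfattoGiulianiMastropietro2006, §2.8 (2.80)] -/
theorem Concrete.tad (h : S.Concrete d₀) (j : ℕ) (hj : j ≠ 0) (hjK : j ≤ S.K) : ‖S.tad j‖ ≤ S.A * S.scale j := by
  obtain ⟨hβ0, -, -, hθ', -, hcL⟩ := h.basic
  have h0 := norm_gridScaleTadpole_le_A (L := L) (M := M) hβ0 h.d₀_pos h.μ4 h.μ0 hθ' h.Λ₀d h.top_le h.le_top hcL hj hjK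
  rw [h.A_eq, sliceGramA]; exact h0

/-- **A valid run from the landed estimates.** [cite: BenfattoGiulianiMastropietro2006, §2.8 (2.80)-(2.88)] -/
theorem Concrete.valid (h : S.Concrete d₀) : S.Valid :=
  { one_le_β := h.one_le_β, Cuv_pos := h.Cuv_pos, Csl_pos := h.Csl_pos, A_pos := h.basic.2.2.2.2.1
    κ₀_pos := by rw [h.κ₀_eq]; exact kappaUV_pos _ _
    τ₀_nonneg := h.τ₀_nonneg, κU_nonneg := h.κU_nonneg, Λ₀_le_one := h.Λ₀_le_one, K_ne_zero := h.K_ne_zero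
    pi_div_le := h.basic.2.1, top_le := h.top_le, le_top := h.le_top
    gram := h.gram, rows := fun j => (h.rows_cols j).1, cols := fun j => (h.rows_cols j).2, tad_le := h.tad
    res := h.res, nu0 := h.nu0, u_le := h.u_le, small₁ := h.small₁, small₂ := h.small₂ }

end FlowSetup

end Literature.MathematicalPhysics.QuantumLattice

end
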